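import Summits.BirchSwinnertonDyer.BirchSwinnertonDyer.Theorems.CyclotomicUntwistPSRankOneUpperHalfAtThreeOfKoValueFormula
import Summits.BirchSwinnertonDyer.BirchSwinnertonDyer.Theorems.CyclotomicUntwistPSRankOneLowerHalfAtThreeOfRestrictedRankZero
import HarnessLib

/-!
# Route `CyclotomicUntwist` on its principal-series rows: BOTH halves K1 ∧ K2 — and the leaf `WAllExclAddWildRankOneSurj` — BY NAME
# from SOED's one-sided cruxes {E′ (+ #4/#5 suppliers), Ko′}, the route's OWN rank-ZERO `3`-adic value formula, the
# supercuspidal residual X3 and print; the wild rank-zero leaf is NOT an input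

Cell `pub/bsd-wall` (D-0145 line `route-BirchSwinnertonDyer-CyclotomicUntwist`), seat `bsd-line-cycu-p4` (width seat 4, gen 4).
Helper toward K1 `PSRankOneLowerHalfAtThree` (stmt-BirchSwinnertonDyer-21580) and K2 `PSRankOneUpperHalfAtThree` (stmt-21581).
THEOREMS ONLY (no definition, no named fact, no `sorry`); every crux / input named is an ANTECEDENT; BSD is not proved by this
file and no crux is.

Summary composition of this seat's two re-keyings — K2 ⟸ PUB ∧ Ko′ ∧ K1₀ (`…OfKoRankZero`), K1 ⟸ PUB ∧ E′ ∧ {V, C | V, PT1} ∧ K2₀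
(`…OfRestrictedRankZero`) — with cycu-p3 g2's `CyclotomicUntwistFiniteSlopeRankZero.rankZero_halves_of_valueFormula`, which types
K1₀ ∧ K2₀ at once from the rank-zero VALUE FORMULA `H` of the route's D1 object (`IsPSCyclotomicLFunctionOf`; on every rank-zero
PS row some admissible `(η, α, 𝓛, ϖ)` with `9·‖𝓛 0 0‖·‖α‖²·‖ϖ‖₃ = ‖#Ш·∏c/#tors²‖₃`):
* **`psHalves_of_soed_of_rankZeroValueFormula : PUB → E′ → V → C → Ko′ → H → K1 ∧ K2`** (and the PT1 variant
  `psHalves_of_soed_of_poitouTate_of_rankZeroValueFormula : PUB → E′ → V → PT1 → Ko′ → H → K1 ∧ K2`);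
* **`wAllExclAddWildRankOneSurj_of_soed_of_rankZeroValueFormula_of_supercuspidal`**: with the route's deciding theorem
  `Theses.CyclotomicUntwist.closes`, the registered leaf `Summit.BirchSwinnertonDyer.WAllExclAddWildRankOneSurj` ⟸ PUB ∧ E′ ∧ V ∧ C
  ∧ Ko′ ∧ H ∧ X3 (`WildSurjRankOneSupercuspidalAtThree`, residual by name).
READING (bookkeeping, not a ruling): modulo print and SOED's research cruxes, the CU route's ENTIRE own input on the onto
wild rank-one PS rows is the rank-ZERO value formula `H` of its typed `3`-adic L-function (IMC₃ for the untwist read at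
`ξ = 𝟙`; no `3`-adic Gross–Zagier, no ψ-line height, no D4/D5) — the rank-ONE finite-slope road (K1's thesis: GZ₃ + leading
term) is an ALTERNATIVE to E′, not a further requirement, once Ko′ and E′ are granted. CONDITIONAL; closes nothing.

References: [JetchevSkinnerWan2017] §7.4.1; [Castella2018] Thm. 2.3; [Jetchev2008] Thm. 1.4; [MazurTateTeitelbaum1986Invent] §I.14;
[Kobayashi2013] Cor. 1.3; [Miller2011LMS] Def. 1.1.
-/

noncomputable section

open scoped Classical MatrixGroups

-- single-conjunct summit: `Summit.BirchSwinnertonDyer.BirchSwinnertonDyer.…` repeats the name by design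
set_option linter.dupNamespace false
set_option autoImplicit false

namespace Summit.BirchSwinnertonDyer.BirchSwinnertonDyer.Theorems.PSHalvesOfSOEDRankZeroValueFormula

open CongruenceSubgroup WeierstrassCurve Literature.NumberTheory.EllipticCurves
  Literature.NumberTheory.EllipticCurves.ModularForms
  Literature.NumberTheory.EllipticCurves.Rank1Residual
  Literature.NumberTheory.EllipticCurves.Rank1Residual.Typed
  Literature.NumberTheory.IwasawaTheory
  Summit.BirchSwinnertonDyer.Rank1Residual
  Summit.BirchSwinnertonDyer.Rank1Residual.Additive
  Summit.BirchSwinnertonDyer.BirchSwinnertonDyer.Theses.SemiOrdinaryEisensteinDescent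
  Summit.BirchSwinnertonDyer.BirchSwinnertonDyer.Theses.CyclotomicUntwist
  Summit.BirchSwinnertonDyer.BirchSwinnertonDyer.Theorems

/-- **K1 ∧ K2 ⟸ PUB ∧ E′ ∧ V ∧ C ∧ Ko′ ∧ the rank-zero value formula `H`** (verbatim the `H` of
`CyclotomicUntwistFiniteSlopeRankZero.rankZero_halves_of_valueFormula`). CONDITIONAL; closes nothing; BSD is not proved by this.
[cite: JetchevSkinnerWan2017, §7.4.1 (arXiv:1512.06894 p. 30)] [cite: MazurTateTeitelbaum1986Invent, §I.14 (case p ∣ N, a_p ≠ 0)] -/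
theorem psHalves_of_soed_of_rankZeroValueFormula (hF : PublishedInputsWildThree)
    (hE' : WildSplitEisensteinInclusionAtThreeRestricted) (hV : WildSplitWaldspurgerAtThree) (hC : WildSplitControlAtThree)
    (hKo' : WildKolyvaginUpperAtThreeTowerFree)
    (H : ∀ (W : WeierstrassCurve ℚ) [W.IsElliptic] [W.IsGloballyMinimal], ¬ W.HasCM →
      ClassO6 W 3 → Surj W 3 →
      Even (padicValInt 3 W.minimalDiscriminantInt) →
      W.minimalDiscriminantInt / 3 ^ padicValInt 3 W.minimalDiscriminantInt % 3 = 1 →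
      W.analyticRank = 0 →
      ∃ (η : DirichletCharacter ℂ_[3] (3 ^ 2)) (α : ℂ_[3]) (𝓛 : (n : ℕ) → ZMod (3 ^ n) → ℂ_[3]) (ϖ : ℚ),
        η.IsPrimitive ∧ α ≠ 0 ∧ IsPSCyclotomicLFunctionOf W η α 𝓛 ∧
        (∀ {N : ℕ} [NeZero N] (f : CuspForm (Gamma0 N) 2), IsNewformOf W f →
          (ϖ : ℝ) * W.realPeriodRat = plusPeriod f) ∧
        9 * ‖𝓛 0 0‖ * ‖α‖ ^ 2 * ‖(ϖ : ℂ_[3])‖ =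
          ‖(((W.shaOrder : ℚ) * (W.tamagawaProduct : ℚ) / (W.torsionOrder : ℚ) ^ 2 : ℚ) : ℂ_[3])‖) :
    PSRankOneLowerHalfAtThree ∧ PSRankOneUpperHalfAtThree :=
  ⟨PSLowerHalfOfRestrictedRankZero.psRankOneLowerHalfAtThree_of_restricted_of_waldspurger_of_control_of_psRankZeroUpperHalf
      hF hE' hV hC (CyclotomicUntwistFiniteSlopeRankZero.rankZero_halves_of_valueFormula hF.2.2.1 H).2,
    PSUpperHalfOfKoRankZero.psRankOneUpperHalfAtThree_of_koTowerFree_of_rankZeroValueFormula hF hKo' H⟩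

/-- **K1 ∧ K2 ⟸ PUB ∧ E′ ∧ V ∧ PT1 ∧ Ko′ ∧ `H`** — crux #5 replaced by Poitou–Tate duality for Selmer structures. CONDITIONAL.
[cite: MilneADT2006, Ch. I, Thm. 4.10(b)] [cite: JetchevSkinnerWan2017, §7.4.1 (arXiv:1512.06894 p. 30)] -/
theorem psHalves_of_soed_of_poitouTate_of_rankZeroValueFormula (hF : PublishedInputsWildThree)
    (hE' : WildSplitEisensteinInclusionAtThreeRestricted) (hV : WildSplitWaldspurgerAtThree)
    (hPT : ∀ (K : Type) [Field K] [NumberField K], Literature.NumberTheory.GaloisCohomology.poitouTate_selmerStructure_duality K)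
    (hKo' : WildKolyvaginUpperAtThreeTowerFree)
    (H : ∀ (W : WeierstrassCurve ℚ) [W.IsElliptic] [W.IsGloballyMinimal], ¬ W.HasCM →
      ClassO6 W 3 → Surj W 3 →
      Even (padicValInt 3 W.minimalDiscriminantInt) →
      W.minimalDiscriminantInt / 3 ^ padicValInt 3 W.minimalDiscriminantInt % 3 = 1 →
      W.analyticRank = 0 →
      ∃ (η : DirichletCharacter ℂ_[3] (3 ^ 2)) (α : ℂ_[3]) (𝓛 : (n : ℕ) → ZMod (3 ^ n) → ℂ_[3]) (ϖ : ℚ),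
        η.IsPrimitive ∧ α ≠ 0 ∧ IsPSCyclotomicLFunctionOf W η α 𝓛 ∧
        (∀ {N : ℕ} [NeZero N] (f : CuspForm (Gamma0 N) 2), IsNewformOf W f →
          (ϖ : ℝ) * W.realPeriodRat = plusPeriod f) ∧
        9 * ‖𝓛 0 0‖ * ‖α‖ ^ 2 * ‖(ϖ : ℂ_[3])‖ =
          ‖(((W.shaOrder : ℚ) * (W.tamagawaProduct : ℚ) / (W.torsionOrder : ℚ) ^ 2 : ℚ) : ℂ_[3])‖) :
    PSRankOneLowerHalfAtThree ∧ PSRankOneUpperHalfAtThree :=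
  ⟨PSLowerHalfOfRestrictedRankZero.psRankOneLowerHalfAtThree_of_restricted_of_waldspurger_of_poitouTate_of_psRankZeroUpperHalf
      hF hE' hV hPT (CyclotomicUntwistFiniteSlopeRankZero.rankZero_halves_of_valueFormula hF.2.2.1 H).2,
    PSUpperHalfOfKoRankZero.psRankOneUpperHalfAtThree_of_koTowerFree_of_rankZeroValueFormula hF hKo' H⟩

/-- **The registered leaf `WAllExclAddWildRankOneSurj` (rung W-ALL/2@3.O6.r1.surj) ⟸ PUB ∧ E′ ∧ V ∧ C ∧ Ko′ ∧ `H` ∧ X3** through the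
route's deciding theorem `Theses.CyclotomicUntwist.closes` (GZK = the third conjunct of PUB; X3 = the supercuspidal residual
`WildSurjRankOneSupercuspidalAtThree`, by name). CONDITIONAL; closes nothing; BSD is not proved by this.
[cite: JetchevSkinnerWan2017, §7.4.1 (arXiv:1512.06894 p. 30)] [cite: Miller2011LMS, Def. 1.1 (arXiv:1010.2431 p. 3)] -/
theorem wAllExclAddWildRankOneSurj_of_soed_of_rankZeroValueFormula_of_supercuspidal (hF : PublishedInputsWildThree)
    (hE' : WildSplitEisensteinInclusionAtThreeRestricted) (hV : WildSplitWaldspurgerAtThree) (hC : WildSplitControlAtThree)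
    (hKo' : WildKolyvaginUpperAtThreeTowerFree)
    (H : ∀ (W : WeierstrassCurve ℚ) [W.IsElliptic] [W.IsGloballyMinimal], ¬ W.HasCM →
      ClassO6 W 3 → Surj W 3 →
      Even (padicValInt 3 W.minimalDiscriminantInt) →
      W.minimalDiscriminantInt / 3 ^ padicValInt 3 W.minimalDiscriminantInt % 3 = 1 →
      W.analyticRank = 0 →
      ∃ (η : DirichletCharacter ℂ_[3] (3 ^ 2)) (α : ℂ_[3]) (𝓛 : (n : ℕ) → ZMod (3 ^ n) → ℂ_[3]) (ϖ : ℚ),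
        η.IsPrimitive ∧ α ≠ 0 ∧ IsPSCyclotomicLFunctionOf W η α 𝓛 ∧
        (∀ {N : ℕ} [NeZero N] (f : CuspForm (Gamma0 N) 2), IsNewformOf W f →
          (ϖ : ℝ) * W.realPeriodRat = plusPeriod f) ∧
        9 * ‖𝓛 0 0‖ * ‖α‖ ^ 2 * ‖(ϖ : ℂ_[3])‖ =
          ‖(((W.shaOrder : ℚ) * (W.tamagawaProduct : ℚ) / (W.torsionOrder : ℚ) ^ 2 : ℚ) : ℂ_[3])‖)
    (hX3 : WildSurjRankOneSupercuspidalAtThree) :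
    Summit.BirchSwinnertonDyer.WAllExclAddWildRankOneSurj :=
  have h := psHalves_of_soed_of_rankZeroValueFormula hF hE' hV hC hKo' H
  closes hF.2.2.1 h.1 h.2 hX3

end Summit.BirchSwinnertonDyer.BirchSwinnertonDyer.Theorems.PSHalvesOfSOEDRankZeroValueFormula

end
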